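import Summits.QuantumFields.YangMills.Theorems.UnitScaleTiltProp8FlatPropagatorSup
import Summits.QuantumFields.YangMills.Theorems.UnitScaleTiltProp8FlatMinimizerH
import Literature.MathematicalPhysics.QuantumFieldTheory.Balaban1983to89.B5G110BlockRowSum
import Literature.MathematicalPhysics.QuantumFieldTheory.Balaban1983to89.B5Ineq110P12Lattice
import Literature.MathematicalPhysics.QuantumFieldTheory.Balaban1983to89.B6BlockDecayHjCovV1
import HarnessLib

/-!
# Route `UnitScaleTilt`, crux K1 child «MinimiserStabilityRegPr» (stmt-QuantumFields-19200), leaves V2′ (one-step halving, Sect. F) and V3 (Prop. 7):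
# **THE FLAT `G = Δ_1⁻¹` ON SOURCES GROWING EXPONENTIALLY AWAY FROM A BLOCK IS BOUNDED THERE** — [Balaban1984PropagatorsI] (1.110)/(1.115), first
# entry, in the exponentially WEIGHTED row-sum form, at the Setup torus (every `Params`), by bridge

Cell `ym3-torus` (HUMAN RULING D-0037, YM ladder rung R3), seat `ym3-torus-p1` gen 14 (UV side); memo HOME/UV3-NODE.md §23.  `--supports
stmt-QuantumFields-19200 --as helper`.  Seventh file of pillar F3 «flat-operator bridge» (OWNER RULING g20-№8 §A), companion of `…FlatMinimizerHDecay` for `G`: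
in [Balaban1985Variational] Sect. F the flat operators act on data that are NOT uniformly small but grow away from the cube `Δ₀ ∋ y₀` ((160): *«|B(x, x′)| <
(8d²L² + 4L²|x − y|)ε₁»*); the kernel decay of `G` absorbs any growth slower than `e^{δ₀|y − y₀|}`.  For the one-level V1 propagator `G = GE (twoScale j hj1 ∅) (L^j) w`,
weight `(L^j)^d` ([B5] `a = 1`):
(b05's block map on the transported torus IS the `j`-fold block point: lit-balaban `B6BlockDecayHjCovV1.blockOf_EK_eq_iterBlockOf`.)
* **`abs_GE_le_of_exp_growth`** — for `0 ≤ J₀`, a rate `δ′ < min{1/(2d), κ₁₈₃(d)/d}` (`d = P.d`), a block `y₀` and a real bond field with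
  `|x(c′)| ≤ J₀·e^{δ′·|y₀ − y(c′)|}` at every bond (`y(c′)` = block of `c′₋`, `|·|` = `distSite` on `T^{(j)}`): `|(Gx)(b)| ≤ J₀·C(d, δ′)` at every bond `b` of
  `B^j(y₀)`, `C(d, δ′) = 2(d−1)2^{d−1}e^{1/(2d)}K_d(1/(2d) − δ′) + d·M_D(d,d−1)C_per(κ₁₈₃(d),d−1)K_d(κ₁₈₃(d)/d − δ′)` — uniform in `j`, `L`, volume
  (b05's `B5G110BlockRowSum.weighted_row_sum_le` through r03's `TV_GE_twoScale_empty` / this lineage's `GE_eq_re`, `exists_EK_eq_bpt_rep`; the block dictionary `B6BlockDecayHjCovV1.blockOf_EK_eq_iterBlockOf`).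
At the d = 3 carrier instantiate `P := F.P K`, `j := K − n`, `hj1 := Prop7FlatCoercivityR.succ_le_T3 F n K`.  HONEST SCOPE: first entry, `a = 1`, flat, one level;
`δ′ = 0` recovers `…FlatPropagatorSup.abs_GE_le_sup`.  No definition, no sorry, standard axioms.  NOT a claim about the mass gap.

References: T. Bałaban, CMP **95** (1984) 17–40 [Balaban1984PropagatorsI] Prop. 1.2 (1.110) p.35, (1.115) p.36; CMP **102** (1985) 277–309 [Balaban1985Variational]
Sect. F (160)–(164) p.302.
-/

set_option autoImplicit false

noncomputable section

open scoped BigOperators InnerProductSpace Matrix ComplexConjugate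

namespace Summit.QuantumFields.YangMills.Theorems.FlatPropagatorWeighted

open Literature.MathematicalPhysics.QuantumFieldTheory.Balaban1983to89
open Literature.MathematicalPhysics.QuantumFieldTheory.BalabanImbrieJaffe1984to88.BIJ85AxialPropagator411 (BondSpace)
open LatticeFieldCalculus B6SectADomainsV1 B6SectAOperatorsV1 B6SectAVectorModelV1 B6SectCTwoScaleV1 B6GOneLevelV1Bridge
open B5Eq117TorusCarriers (Mk EK)
open B5Eq118OneStroke (iterBlockOf)
open B5Prop11Plancherel (Tor fine)
open B5DeltaA169 (DeltaA)
open B5Block118 (bpt)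
open B5Blocks16 (blockOf_bpt)
open B4TorusKernel (periodConst)
open B4TorusKernel.MultiPeriod (torusSupNorm)
open B5G183Strip (kappa183 kappa183_pos)
open B5G183CovDecay (MD183 MD183_nonneg)
open B5Kernel166Decay (periodConst_pos)
open B6LowerBound2153Torus (toT rep toT_rep)
open B4Sect5Proof (latticeConst latticeConst_nonneg)
open B5Prop12FieldsLattice (distSite)
open B5Ineq110P12Lattice (distSite_eq_torusSupNorm)
open B5G110BlockRowSum (weighted_row_sum_le)
open FlatPropagatorSup (GE_eq_re)
open FlatMinimizerH (exists_EK_eq_bpt_rep)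

variable {P : Params} {j : ℕ}

/-- **THE FLAT `G = Δ_1⁻¹` ON SOURCES GROWING EXPONENTIALLY AWAY FROM A BLOCK** ([Balaban1984PropagatorsI] (1.110)/(1.115) first entry in the WEIGHTED
form Sect. F of [Balaban1985Variational] consumes at (162)–(164), where the data grow like `|x − y|` away from `Δ₀ ∋ y₀` — cf. (160)): for the one-level V1
propagator at weight `(L^j)^d` (a = 1), every `P : Params`, a rate `0 ≤ δ′ < min{1/(2d), κ₁₈₃(d)/d}`, a block `y₀ ∈ T^{(j)}` and a real bond field with
`|x(c′)| ≤ J₀·e^{δ′|y₀ − y(c′)|}` for every bond `c′` (`y(c′)` = the `j`-block of `c′₋`, `|·|` = `distSite`): at every bond `b` issuing from `B^j(y₀)`,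
`|(Gx)(b)| ≤ J₀·(C₁(d)K_d(1/(2d) − δ′) + d·C₂(d)K_d(κ₁₈₃(d)/d − δ′))` — b05's `B5G110BlockRowSum.weighted_row_sum_le` (uniform in `n = L^j` and the
volume) through r03's bridge. [cite: Balaban1984PropagatorsI, (1.110) p.35, (1.115) p.36; Balaban1985Variational, Sect. F (160)-(164) p.302] -/
theorem abs_GE_le_of_exp_growth (hj1 : j + 1 ≤ P.m + P.K)
    {w : BondIdx (twoScale j hj1 (∅ : Finset (Site P (j + 1)))) → ℝ}
    (hw : ∀ i, 0 < w i) (hwa : ∀ p, w p = ((P.L : ℝ) ^ j) ^ P.d) (x : BondSpace P) (y₀ : Site P j) {J₀ δ' : ℝ} (hJ₀ : 0 ≤ J₀)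
    (h₁ : δ' < 1 / (2 * P.d)) (h₂ : δ' < kappa183 P.d / P.d)
    (hx : ∀ c' : PBond P 0, |x c'| ≤ J₀ * Real.exp (δ' * distSite (Mk P j) y₀ (iterBlockOf j c'.src)))
    (b : PBond P 0) (hb : iterBlockOf j b.src = y₀) :
    |GE (twoScale j hj1 ∅) (c := (P.L : ℝ) ^ j) (pow_ne_zero j (Nat.cast_ne_zero.2 P.L_pos.ne')) hw x b|
      ≤ J₀ * (2 * (P.d - 1 : ℕ) * 2 ^ (P.d - 1) * Real.exp (1 / (2 * P.d)) * latticeConst P.d (1 / (2 * P.d) - δ')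
          + P.d * (MD183 P.d (P.d - 1) * periodConst (kappa183 P.d) (P.d - 1) * latticeConst P.d (kappa183 P.d / P.d - δ'))) := by
  have hj : j ≤ P.m + P.K := Nat.le_of_succ_le hj1
  rw [GE_eq_re hj1 hw hwa x b]
  obtain ⟨r, hr⟩ := exists_EK_eq_bpt_rep hj b.src
  rw [hr, hb]
  obtain ⟨dP, L, m, K, hd, hL⟩ := P
  obtain ⟨d, rfl⟩ : ∃ d, dP = d + 1 := ⟨dP - 1, by omega⟩
  have hn : 1 ≤ L ^ j := Nat.one_le_pow _ _ (by have := hL.2; omega)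
  haveI : NeZero (L ^ j) := ⟨by have := hL.2; positivity⟩
  refine (Complex.abs_re_le_norm _).trans ?_
  -- `|(G x̃)(i)| ≤ Σ_j |G(i,j)| |x̃ j| ≤ J₀ Σ_j e^{δ′|y₀ − block j|} |G(i,j)|`
  have h1 : ‖((DeltaA (L ^ j) (Mk (⟨d + 1, L, m, K, hd, hL⟩ : Params) j) 1)⁻¹ *ᵥ TV (P := (⟨d + 1, L, m, K, hd, hL⟩ : Params)) hj x)
        (bpt (L ^ j) (Mk (⟨d + 1, L, m, K, hd, hL⟩ : Params) j)
          (toT (Mk (⟨d + 1, L, m, K, hd, hL⟩ : Params) j) (rep (Mk (⟨d + 1, L, m, K, hd, hL⟩ : Params) j) y₀)) r, b.dir)‖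
      ≤ ∑ i, Real.exp (δ' * torusSupNorm (Mk (⟨d + 1, L, m, K, hd, hL⟩ : Params) j)
            (rep (Mk (⟨d + 1, L, m, K, hd, hL⟩ : Params) j) (toT (Mk (⟨d + 1, L, m, K, hd, hL⟩ : Params) j)
              (rep (Mk (⟨d + 1, L, m, K, hd, hL⟩ : Params) j) y₀))
              - rep (Mk (⟨d + 1, L, m, K, hd, hL⟩ : Params) j) (B5Blocks16.blockOf (L ^ j) (Mk (⟨d + 1, L, m, K, hd, hL⟩ : Params) j) i.1)))
          * ‖(DeltaA (L ^ j) (Mk (⟨d + 1, L, m, K, hd, hL⟩ : Params) j) 1)⁻¹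
              (bpt (L ^ j) (Mk (⟨d + 1, L, m, K, hd, hL⟩ : Params) j)
                (toT (Mk (⟨d + 1, L, m, K, hd, hL⟩ : Params) j) (rep (Mk (⟨d + 1, L, m, K, hd, hL⟩ : Params) j) y₀)) r, b.dir) i‖ * J₀ := by
    simp only [Matrix.mulVec, dotProduct]
    refine (norm_sum_le _ _).trans (Finset.sum_le_sum fun i _ => ?_)
    rw [norm_mul, mul_comm (Real.exp _), mul_assoc]
    refine mul_le_mul_of_nonneg_left ?_ (norm_nonneg _)
    obtain ⟨z, κ⟩ := i
    rw [TV_apply, Complex.norm_real, Real.norm_eq_abs, toT_rep]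
    have hxc := hx ⟨(EK (P := (⟨d + 1, L, m, K, hd, hL⟩ : Params)) hj).symm z, κ⟩
    rw [distSite_eq_torusSupNorm, ← B6BlockDecayHjCovV1.blockOf_EK_eq_iterBlockOf (P := (⟨d + 1, L, m, K, hd, hL⟩ : Params)) hj, Equiv.apply_symm_apply, mul_comm] at hxc
    exact hxc
  refine h1.trans ?_
  rw [← Finset.sum_mul, mul_comm]
  refine mul_le_mul_of_nonneg_left ?_ hJ₀
  have h₁' : δ' < 1 / (2 * ((d : ℝ) + 1)) := by simpa using h₁
  have h₂' : δ' < kappa183 (d + 1) / ((d : ℝ) + 1) := by simpa using h₂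
  have hw := weighted_row_sum_le (L ^ j) hn (Mk (⟨d + 1, L, m, K, hd, hL⟩ : Params) j) (Nn := d) le_rfl h₁' h₂'
    (toT (Mk (⟨d + 1, L, m, K, hd, hL⟩ : Params) j) (rep (Mk (⟨d + 1, L, m, K, hd, hL⟩ : Params) j) y₀)) r b.dir
  simpa using hw

end Summit.QuantumFields.YangMills.Theorems.FlatPropagatorWeighted

end
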